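/-
Copyright (c) 2026 the pub-hodgecm-mathlib formalisation cell (harness21).  Prover seat hodgecm-mathlib-K2Liu-p06 (g2): Track B «K2-LIT»,
#184♮ = hLiu418 = stmt-HodgeConjecture-24832; organ O33.1 for socket #33s `sig_K2LiuZetaSNonvanishingData` of the tier-1 socket module
`Cruxes/HLiu418/Lines/K2_Liu_CurveThetaSigs_U5d_ZetaS.lean` (ED. 2, sha16 658c80e5f6458509, :420; LEAD F0P6-plan (g10) RE-DEAL 2026-09-04T02:26:33Z); 2026-09-04.
-/
import Literature.NumberTheory.Automorphic.IntegratedOperator      -- ★ `ContRepresentation.integratedOperator`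
import HarnessLib

/-!
# Crux `HLiu418`, Track B road `K2_Liu`, unit U5d «`Z_S`», socket #33s — organ O33.1:
# a non-zero vector of the cyclic closed span of `v` pairs non-trivially with some translate `π(g) v`

Cell `hodgecm-mathlib`, crux item hLiu418 = `stmt-HodgeConjecture-24832`, route of record `HCCMUnconditional`; squad K2 ∕ K2Liu,
LEAD F0P6-plan (g10), planner K2Liu-plan (g2), prover K2Liu-p06 (g2).  THEOREMS ONLY (no `def`, no instance, no notation, no
named-fact hypothesis, no `sorry`, default heartbeats); lane `--supports stmt-HodgeConjecture-24832` (count-neutral helper).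

WHAT IS PROVED (generic Hilbert space `H`, any `π : ContRepresentation ℂ G H`).  With `C(v) :=` the topological closure of
`span_ℂ {π(g) v : g ∈ G}` (the cyclic closed subspace of `v`):
* `eq_zero_of_mem_closure_span_of_forall_inner_eq_zero` — `u ∈ C(v)` and `⟪u, π(g) v⟫ = 0` for all `g` force `u = 0`;
* `exists_inner_translate_ne_zero` — hence a NON-ZERO `u ∈ C(v)` has `⟪u, π(g) v⟫ ≠ 0` for some `g`;
* `integratedOperator_apply_mem_closure_span` — for `π` unitary and strongly continuous, every integrated operator `π(f)`
  (`f ∈ C_c(G)`, ★ `integratedOperator`) maps `v` into `C(v)` (`C(v)ᗮᗮ = C(v)` and `⟪w, ∫ f(g) π(g) v⟫ = ∫ f(g) ⟪w, π(g) v⟫`);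
* `exists_inner_integratedOperator_translate_ne_zero` — so `π(f) v ≠ 0 ⇒ ∃ g, ⟪π(f) v, π(g) v⟫ ≠ 0`;
* ED. 2 (append-only): the `L¹` forms `integral_smul_apply_mem_closure_span` ∕ `exists_inner_integral_smul_translate_ne_zero` for an
  arbitrary integrable weight (the doubling weight `f_φ` of #33s is `L¹` by the #32d decay, not compactly supported).
This is step §1 of the #33s reduction (memo `K2/K2Liu-p06/g2/REPORT-FIRST-33s-ZetaSNonvanishingData.K2Liup06g2.md`): the doubling zeta
value `Z_S(φ, φ₁, φ₁(g₀ • ·))` is `⟪T_{f_φ}[φ₁], R(g₀⁻¹)[φ₁]⟫`, so a non-zero smear `T_{f_φ}[φ₁]` yields the `g₀` of the socket.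

HONEST LABEL.  Count-neutral scaffold file of the K2_Liu road; it pays nothing by itself: `HC_CM` is proved only modulo the 7 printed citations
(2 remaining named inputs: hLiu418 = `stmt-HodgeConjecture-24832`, h413 = `stmt-HodgeConjecture-24833`) until rung 0 closes.

## References
* [DeitmarEchterhoff2014] A. Deitmar, S. Echterhoff, *Principles of Harmonic Analysis*, 2nd ed. (2014): Prop. 6.2.1, Lemma 6.1.7 (cyclic
  subspaces, integrated representations).
* [Folland1995] G. B. Folland, *A Course in Abstract Harmonic Analysis* (1995): §3.1–3.2.
* [Liu2011] Y. Liu, Algebra Number Theory 5 (2011): §2B Prop. 2.3 p. 862 (the use: `Z_S ≠ 0` for a good choice of the second vector).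
-/

set_option autoImplicit false
set_option linter.dupNamespace false

noncomputable section

open scoped InnerProductSpace
open MeasureTheory Filter Topology

namespace Summit.HodgeConjecture.HodgeConjecture.Cruxes.HLiu418.K2LiuCyclicSpanNonvanishing

variable {G H : Type*} [Group G] [NormedAddCommGroup H] [InnerProductSpace ℂ H]

/-- **A vector of the cyclic closed span of `v` orthogonal to every translate `π(g) v` is zero**: orthogonality to the `π(g) v` gives
orthogonality to their span, hence (continuity of `⟪u, ·⟫`) to its closure, which contains `u`. [cite: DeitmarEchterhoff2014, Lemma 6.1.7] -/
theorem eq_zero_of_mem_closure_span_of_forall_inner_eq_zero (π : ContRepresentation ℂ G H) (v : H) {u : H}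
    (hu : u ∈ (Submodule.span ℂ (Set.range fun g : G => π g v)).topologicalClosure) (h : ∀ g : G, ⟪u, π g v⟫_ℂ = 0) : u = 0 := by
  -- `⟪u, ·⟫` vanishes on the span, hence on its closure
  have hspan : ∀ w ∈ Submodule.span ℂ (Set.range fun g : G => π g v), ⟪u, w⟫_ℂ = 0 := by
    intro w hw
    refine Submodule.span_induction (fun x hx => ?_) (inner_zero_right _) (fun x y _ _ hx hy => ?_) (fun c x _ hx => ?_) hw
    · obtain ⟨g, rfl⟩ := hx
      exact h g
    · rw [inner_add_right, hx, hy, add_zero]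
    · rw [inner_smul_right, hx, mul_zero]
  have hcont : Continuous fun w : H => ⟪u, w⟫_ℂ := continuous_const.inner continuous_id
  have hclosed : IsClosed {w : H | ⟪u, w⟫_ℂ = 0} := isClosed_eq hcont continuous_const
  have hu' : u ∈ closure ((Submodule.span ℂ (Set.range fun g : G => π g v) : Submodule ℂ H) : Set H) := by
    rwa [← Submodule.topologicalClosure_coe]
  have hsub : ((Submodule.span ℂ (Set.range fun g : G => π g v) : Submodule ℂ H) : Set H) ⊆ {w : H | ⟪u, w⟫_ℂ = 0} :=
    fun w hw => hspan w hw
  exact inner_self_eq_zero.1 ((hclosed.closure_subset_iff.2 hsub) hu')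

/-- **A non-zero vector of the cyclic closed span of `v` pairs non-trivially with some `π(g) v`.** [cite: DeitmarEchterhoff2014, Lemma 6.1.7] -/
theorem exists_inner_translate_ne_zero (π : ContRepresentation ℂ G H) (v : H) {u : H}
    (hu : u ∈ (Submodule.span ℂ (Set.range fun g : G => π g v)).topologicalClosure) (hu0 : u ≠ 0) :
    ∃ g : G, ⟪u, π g v⟫_ℂ ≠ 0 := by
  by_contra hcon
  exact hu0 (eq_zero_of_mem_closure_span_of_forall_inner_eq_zero π v hu fun g =>
    Classical.byContradiction fun h' => hcon ⟨g, h'⟩)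

variable [CompleteSpace H] [TopologicalSpace G] [MeasurableSpace G] [OpensMeasurableSpace G]

/-- **`π(f) v` lies in the cyclic closed span of `v`** (`π` unitary, strongly continuous, `f ∈ C_c(G)`, `η` finite on compact sets): the closed span
is `(span)ᗮᗮ`, and for `w ⟂ span`, `⟪w, ∫ f(g) • π(g) v dη⟫ = ∫ f(g) ⟪w, π(g) v⟫ dη = 0`. [cite: DeitmarEchterhoff2014, Prop. 6.2.1] [cite: Folland1995, §3.2] -/
theorem integratedOperator_apply_mem_closure_span {π : ContRepresentation ℂ G H} (hu : π.IsUnitary) (hc : π.IsStronglyContinuous)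
    (η : Measure G) [IsFiniteMeasureOnCompacts η] (f : CompactlySupportedContinuousMap G ℂ) (v : H) :
    π.integratedOperator hu hc η f v ∈ (Submodule.span ℂ (Set.range fun g : G => π g v)).topologicalClosure := by
  rw [← Submodule.orthogonal_orthogonal_eq_closure, Submodule.mem_orthogonal]
  intro w hw
  rw [ContRepresentation.integratedOperator_apply, ← integral_inner (ContRepresentation.integrable_smul_apply hc η f v) w]
  refine integral_eq_zero_of_ae (Eventually.of_forall fun g => ?_)
  have hgv : π g v ∈ Submodule.span ℂ (Set.range fun g : G => π g v) := Submodule.subset_span ⟨g, rfl⟩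
  change ⟪w, f g • π g v⟫_ℂ = 0
  rw [inner_smul_right, Submodule.inner_left_of_mem_orthogonal hgv hw, mul_zero]

/-- **Non-zero smears pair non-trivially with a translate**: if `π(f) v ≠ 0` then `⟪π(f) v, π(g) v⟫ ≠ 0` for some `g ∈ G`.  (The form used by
#33s: `Z_S(φ, φ₁, φ₁(g₀ • ·)) = ⟪T_{f_φ}[φ₁], R(g₀⁻¹)[φ₁]⟫`, so a non-vanishing smear gives the `g₀` of the socket.)
[cite: Liu2011, §2B Prop. 2.3 p. 862] [cite: DeitmarEchterhoff2014, Lemma 6.1.7] -/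
theorem exists_inner_integratedOperator_translate_ne_zero {π : ContRepresentation ℂ G H} (hu : π.IsUnitary)
    (hc : π.IsStronglyContinuous) (η : Measure G) [IsFiniteMeasureOnCompacts η] (f : CompactlySupportedContinuousMap G ℂ) (v : H)
    (hne : π.integratedOperator hu hc η f v ≠ 0) :
    ∃ g : G, ⟪π.integratedOperator hu hc η f v, π g v⟫_ℂ ≠ 0 :=
  exists_inner_translate_ne_zero π v (integratedOperator_apply_mem_closure_span hu hc η f v) hne

omit [TopologicalSpace G] [OpensMeasurableSpace G] in
/-- **`L¹` form**: for ANY weight `f : G → ℂ` with `g ↦ f(g) • π(g) v` Bochner-integrable (e.g. `f ∈ L¹(η)` and `π` unitary strongly continuous),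
`∫ f(g) • π(g) v dη` lies in the cyclic closed span of `v` (same proof: pair with `w ⟂ span`). [cite: Folland1995, §3.2] -/
theorem integral_smul_apply_mem_closure_span (π : ContRepresentation ℂ G H) (η : Measure G) {f : G → ℂ} (v : H)
    (hf : Integrable (fun g => f g • π g v) η) :
    (∫ g, f g • π g v ∂η) ∈ (Submodule.span ℂ (Set.range fun g : G => π g v)).topologicalClosure := by
  rw [← Submodule.orthogonal_orthogonal_eq_closure, Submodule.mem_orthogonal]
  intro w hw
  rw [← integral_inner hf w]
  refine integral_eq_zero_of_ae (Eventually.of_forall fun g => ?_)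
  have hgv : π g v ∈ Submodule.span ℂ (Set.range fun g : G => π g v) := Submodule.subset_span ⟨g, rfl⟩
  change ⟪w, f g • π g v⟫_ℂ = 0
  rw [inner_smul_right, Submodule.inner_left_of_mem_orthogonal hgv hw, mul_zero]

omit [TopologicalSpace G] [OpensMeasurableSpace G] in
/-- **`L¹` form of the non-vanishing pairing**: if `∫ f(g) • π(g) v dη ≠ 0` (integrable integrand) then `⟪∫ f • π v, π(g) v⟫ ≠ 0` for some `g`
— the shape #33s uses (the doubling weight `f_φ` is integrable by the #32d decay but not compactly supported). [cite: Liu2011, §2B Prop. 2.3 p. 862] -/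
theorem exists_inner_integral_smul_translate_ne_zero (π : ContRepresentation ℂ G H) (η : Measure G) {f : G → ℂ} (v : H)
    (hf : Integrable (fun g => f g • π g v) η) (hne : (∫ g, f g • π g v ∂η) ≠ 0) :
    ∃ g : G, ⟪∫ g', f g' • π g' v ∂η, π g v⟫_ℂ ≠ 0 :=
  exists_inner_translate_ne_zero π v (integral_smul_apply_mem_closure_span π η v hf) hne

end Summit.HodgeConjecture.HodgeConjecture.Cruxes.HLiu418.K2LiuCyclicSpanNonvanishing

end
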